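import Mathlib.AlgebraicTopology.FundamentalGroupoid.FundamentalGroup
import Mathlib.Data.ZMod.Basic
import Mathlib.Algebra.Module.Pi
import Mathlib.Algebra.BigOperators.Pi
import Mathlib.Algebra.Group.TypeTags.Finite
import Mathlib.SetTheory.Cardinal.NatCard
import Mathlib.Algebra.Group.Pi.Lemmas
import Mathlib.Data.Fintype.Pi
import Mathlib.Data.Countable.Small
import Mathlib.Algebra.Group.Shrink
import Mathlib.GroupTheory.FiniteAbelian.Basic
import Mathlib.GroupTheory.Abelianization.Finite
import Literature.Topology.FourManifolds.GroupTrisections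
import Literature.Topology.FourManifolds.SmoothOrientation
import Literature.GroupTheory.CombinatorialGroupTheory.FreeGroupResiduallyFinite
import HarnessLib

/-!
# Profinite detection of `#ᵏ(S¹ × S²)`: a closed orientable 3-manifold group with the finite
# quotients of `F_k` is `F_k` (Wilton–Zalesskii 2019, Thm. A, with Kneser–Milnor)

Topic `Literature/Topology/FourManifolds`; companion of `FreeFundamentalGroupThreeManifold.lean`
(Kneser–Stallings–Perelman: free `π₁` of rank `k` ⟹ `Y ≅ #ᵏ(S¹ × S²)`) and
`HeegaardSplittingsS1S2Sums.lean` (Waldhausen).  Wanted by route `SmoothPoincare4/CongruenceShadows`,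
crux `HeegaardHandlebodyCongruenceClosed` (item stmt-SmoothPoincare4-14596), line
`pair-rigidity-retraction`, stub P2 `stub_profiniteFreenessDetection`: *if the pair quotient
`S_g ⧸ ⟪N_i ∪ θN₂⟫` of two handlebody kernels has exactly the finite quotients of `F_{m+1}`, it is
free of rank `m+1`*.  TWO named facts (D-0014) and ONE proved corollary; no new vocabulary.

## Sources (read)

* H. Wilton, P. Zalesskii, *Profinite detection of 3-manifold decompositions*, Compositio Math.
  155 (2019) 246–259 = arXiv:1703.03701 (held: `lit read arxiv:1703.03701`, chunks 2 and 6).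
  **Theorem A** (Introduction), verbatim: "Let `M, N` be closed, orientable 3-manifolds with
  Kneser–Milnor decompositions `M ≅ M₁ # … # M_m # r(S¹ × S²)` and `N ≅ N₁ # … # N_n # s(S¹ × S²)`.
  If `π̂₁M ≅ π̂₁N` then `m = n`, `r = s`, and up to re-indexing, `π̂₁Mᵢ` is conjugate to `π̂₁Nᵢ`
  for each `i`."  Restated and proved as **Theorem 2.2 (Profinite Kneser–Milnor)** in §2, after:
  "If `M` is a closed, oriented 3-manifold then the Kneser–Milnor decomposition decomposes `M` as
  a connect sum `M ≅ N₁ # … # N_m # F_r` where each `Nᵢ` is irreducible and `F_r` is a connect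
  sum of copies of `S¹ × S²`. The `Nᵢ` are uniquely determined, in an appropriate sense. … the
  integer `r` is also unique."  Introduction, p. 1: "The set of finite quotients of a group `Γ`
  is encoded by the profinite completion `Γ̂` (the inverse limit of the system of finite quotient
  groups)". [WiltonZalesskii2019]
* J. D. Dixon, E. W. Formanek, J. C. Poland, L. Ribes, *Profinite completions and isomorphic
  finite quotients*, J. Pure Appl. Algebra 23 (1982) 227–231: two finitely generated groups have
  isomorphic profinite completions if and only if they have the same (isomorphism classes of)
  finite quotients (also Ribes–Zalesskii, *Profinite Groups*, 2nd ed. (2010), Cor. 3.2.8).  Not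
  held (`lit` acquisition requested); used only to read "`π̂₁Y ≅ F̂_k`" as "`π₁Y` and `F_k` have
  the same finite quotients" for the finitely generated group `π₁Y`. [DixonFormanekPolandRibes1982]
* J. Hempel, *3-Manifolds*, Ann. of Math. Studies 86 (1976): Ch. 3 (connected sums,
  `π₁(M₁ # M₂) = π₁M₁ ∗ π₁M₂`, so `π₁(#ᵏ S¹ × S²) = F_k`); Lemma 14.4 (for a Heegaard splitting
  `(M; U, V)` with surface `T`, `π₁(M) ≅ π₁(T) ⧸ ⟪ker(π₁T → π₁U) ∪ ker(π₁T → π₁V)⟫`, Seifert–van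
  Kampen) and Lemma 14.5 (= Jaco 1969: for `T` closed orientable of genus `g`, every
  `φ₁ × φ₂ : π₁(T) → F_g × F_g` with both `φᵢ` epic is equivalent to the splitting homomorphism of
  a Heegaard splitting of some closed orientable 3-manifold). [Hempel1976] [Jaco1969]
* C. Leininger, A. Reid, *The co-rank conjecture for 3-manifold groups*, AGT 2 (2002), Lemma 2.2
  (every epimorphism `π₁(Σ_g) ↠ F_g` is induced by the inclusion of `Σ_g` as the boundary of a
  handlebody); A. Hatcher, *Algebraic Topology* (2002), Thm. 1.20 (van Kampen), p. 51
  (`π₁(Σ_g) = ⟨a₁, b₁, …, a_g, b_g ∣ ∏[aᵢ, bᵢ]⟩`). [LeiningerReid2002] [HatcherAT2002]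

## Content

* `isFreeOfRank_fundamentalGroup_of_sameFiniteQuotients` — NAMED FACT (Wilton–Zalesskii Thm. A
  applied with `N = #ᵏ(S¹ × S²)`, read on fundamental groups): a closed connected orientable smooth
  3-manifold `Y` whose `π₁(Y, y)` has exactly the finite quotients of `F_k` has `π₁(Y, y)` free of
  rank `k`.  Derivation in print: `π₁Y` is finitely generated (compact manifold), so "same finite
  quotients" is `π̂₁Y ≅ F̂_k = π̂₁(#ᵏ S¹ × S²)` (Dixon–Formanek–Poland–Ribes); the Kneser–Milnor
  decomposition of `#ᵏ(S¹ × S²)` has no irreducible summand and `s = k`, so by Thm. A that of `Y`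
  has `m = 0`, `r = k`, i.e. `Y ≅ #ᵏ(S¹ × S²)` and `π₁Y ≅ F_k` (Hempel Ch. 3).  (Perelman's
  theorem is inside the Kneser–Milnor statement used by the source: irreducible summands have
  non-trivial, residually finite `π₁`.)
* `exists_closedThreeManifold_fundamentalGroup_pairQuotient` — NAMED FACT (Hempel Lemma 14.5 =
  Jaco 1969, with Lemma 14.4; Leininger–Reid Lemma 2.2), group-to-manifold bridge read on `π₁`
  only: for subgroups `K₁, K₂ ≤ S_g` with `S_g ⧸ ⟪Kᵢ⟫ ≅ F_g` (`i = 1, 2`) there is a closed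
  connected orientable smooth 3-manifold `Y` — a Heegaard splitting `H₁ ∪_Σ H₂` realising the two
  epimorphisms `S_g = π₁Σ_g ↠ S_g ⧸ ⟪Kᵢ⟫ ≅ F_g` as `π₁Σ → π₁Hᵢ` — with
  `π₁(Y, y) ≅ S_g ⧸ ⟪K₁ ∪ K₂⟫`.  The tree's sibling item `WaldhausenPairs` (stmt-SmoothPoincare4-14592,
  line `jaco-splitting-homomorphism`) carries the STRONG form of the same two lemmas (the splitting,
  its gluing data and a marking of the Heegaard surface exposed: `JacoPairRealization`, and van
  Kampen `VanKampenPairQuotient` proved there from landed Theorems files); this fact is their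
  composite with the splitting forgotten, which is all that profinite detection consumes.
* `isFreeOfRank_pairQuotient_of_sameFiniteQuotients` — PROVED from the two facts: for
  `K₁, K₂ ≤ S_g` with `S_g ⧸ ⟪Kᵢ⟫ ≅ F_g`, if `S_g ⧸ ⟪K₁ ∪ K₂⟫` has exactly the finite quotients of
  `F_k` then it is free of rank `k` (the statement stub P2 instantiates at `g = 3 + 3m`,
  `k = m + 1`, `K₁ = N_i`, `K₂ = θN₂`).

## Design choices / what is NOT here

* "Same finite quotients as `F_k`" is spelled out, for finite groups `Q : Type`, as
  `(∃ f : G →* Q, Surjective f) ↔ (∃ f : F_k →* Q, Surjective f)`; no profinite completion is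
  built (Mathlib has `ProfiniteGrp` but not the completion functor's adjunction API needed to say
  `Ĝ ≅ F̂_k` conveniently), and the Dixon–Formanek–Poland–Ribes translation is part of the citation.
* "Closed connected orientable smooth 3-manifold" and "`#ᵏ(S¹ × S²)`-recognition on `π₁`" are said
  exactly as in `FreeFundamentalGroupThreeManifold.lean` (charts in `ℝ³`, `CompactSpace`,
  `ConnectedSpace`, `IsOrientable (𝓡 3)`, Mathlib's `FundamentalGroup Y y`,
  `Literature.Topology.FourManifolds.IsFreeOfRank`).
* NOT here: the general Thm. A (matching of all Kneser–Milnor summands: needs connected-sum /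
  prime-decomposition vocabulary for 3-manifolds, absent from the tree), Thm. B (JSJ), profinite
  rigidity of any other manifold; the diffeomorphism `Y ≅ #ᵏ(S¹ × S²)` itself (obtainable from the
  conclusion and `diffeomorph_sumS1S2_of_isFreeOfRank_fundamentalGroup`).

## Status of `exists_closedThreeManifold_fundamentalGroup_pairQuotient` (split review
`rsplit-Literature.Topology.FourManifo-a814191e15-g2`, 2026-08-16; statement re-read against Hempel,
pp. 157–158, and kept verbatim)

The fact is Hempel's Lemma 14.4 (proof, p. 158: "By Van Kampen's theorem, `j_* : π₁(T) → π₁(M)` is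
epic and `ker j_* = ker φ₁ · ker φ₂`") composed with Lemma 14.5 (Jaco).  Lemma 14.4, the genus
stabilisation `g ↦ g + 3` and the composition are PROVED in `ProfiniteDetectionSumS1S2Proofs.lean`
(`HeegaardVanKampen.nonempty_mulEquiv_quotient`; §5
`exists_closedThreeManifold_fundamentalGroup_pairQuotient_of_realization :
exists_heegaardSplitting_realizing_kernels → exists_closedThreeManifold_fundamentalGroup_pairQuotient`;
§7 `…_of_univ_zero`, the instance in `Type` gives every universe).  So this fact carries no proof
obligation of its own beyond the named fact `exists_heegaardSplitting_realizing_kernels`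
(`HeegaardSplittingRealization.lean`: Lemma 14.5 in kernel form, `g ≥ 2`), which
`HeegaardSplittingRealizationProofs.lean` reduces in turn to ONE classical input about one marked
surface per genus — Leininger–Reid (2002), Lemma 2.2 (the printed road: transversality of a map
`Σ_g → ⋁ᵍ S¹`, 2-handles along the preimage curves, Hopficity of `F_g`; hypothesis form,
`…_of_leiningerReid`), or kernel-transitivity of the boundary diffeomorphisms of one marked handlebody
(`…_of_transitive`), or the two NAMED facts `GrigorchukKurchanov1990_stronglyEquivalent`
(`SurfaceGroupEpimorphisms.lean`; uniqueness of epimorphisms `S_g ↠ F_g` up to `Aut S_g`, Zieschang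
1964 / Grigorchuk–Kurchanov 1990; its equal-kernel case is proved,
`SurfaceGroup.exists_mulEquiv_map_cutKernel_eq` in `HandlebodyGroupRealisation.lean`) and
`DehnNielsenBaerSurfaceSmooth` (`DehnNielsenBaerSurface.lean`; proved in genus `≤ 1`,
`dehnNielsenBaerSurfaceSmooth_of_le_one`, and reduced in genus `≥ 2` to the realisation of one
generating set of `Aut π₁` on the flower surface, `dehnNielsenBaerSurfaceSmooth_of_flower_generators`):
`exists_closedThreeManifold_fundamentalGroup_pairQuotient_of_stronglyEquivalent_of_dehnNielsenBaerSurfaceSmooth`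
(§8 of the Proofs file).  The discharge `…_holds` is that theorem applied to the two `_holds` once
they land; neither leaf is an inline proof (Nielsen cancellation for quadratic words, resp. the
Dehn–Nielsen–Baer theorem for `g ≥ 2`; Jaco's own paper, Trans. AMS 144 (1969), is not held,
acq-06129).  The statement is not mis-cut; it stays a `def` — rather than being merged into the
hypothesis `exists_heegaardSplitting_realizing_kernels` of its consumers — only because Summits
theorems take `(h : exists_closedThreeManifold_fundamentalGroup_pairQuotient)` by name
(`CongruenceShadowsHeegaardPairFreenessDetection`,
`CongruenceShadowsHeegaardHandlebodyCongruenceClosedStubProfiniteFreenessDetection`, crux sketches of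
`HeegaardPairFreenessDetection`).  New consumers should take
`(h : exists_heegaardSplitting_realizing_kernels)` and apply
`exists_closedThreeManifold_fundamentalGroup_pairQuotient_of_realization h`; once no importer names
the `def`, it can be deleted in favour of that theorem.
-/

noncomputable section

open scoped Manifold ContDiff
open Function Subgroup

namespace Literature.Topology.FourManifolds

universe u

/-! ### Transfer of "same finite quotients" along an isomorphism -/

/-- Isomorphic groups have the same quotients: if `G ≃* G'` then `G` surjects onto `Q` iff `G'`
does. [folklore] -/
theorem exists_surjective_monoidHom_iff_of_mulEquiv {G G' Q : Type*} [Group G] [Group G']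
    [Group Q] (e : G ≃* G') :
    (∃ f : G →* Q, Function.Surjective f) ↔ (∃ f : G' →* Q, Function.Surjective f) := by
  constructor
  · rintro ⟨f, hf⟩
    exact ⟨f.comp e.symm.toMonoidHom, hf.comp e.symm.surjective⟩
  · rintro ⟨f, hf⟩
    exact ⟨f.comp e.toMonoidHom, hf.comp e.surjective⟩

/-! ### The two named facts -/

/-- **Wilton–Zalesskii 2019, Theorem A, for `#ᵏ(S¹ × S²)`, on fundamental groups: a closed
orientable 3-manifold group with exactly the finite quotients of the free group `F_k` is free of
rank `k`.**  Print (Compositio 155 (2019), Thm. A = Thm. 2.2 "Profinite Kneser–Milnor"): "Let `M, N`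
be closed, orientable 3-manifolds with Kneser–Milnor decompositions `M ≅ M₁ # … # M_m # r(S¹ × S²)`
and `N ≅ N₁ # … # N_n # s(S¹ × S²)`. If `π̂₁M ≅ π̂₁N` then `m = n`, `r = s`, and up to re-indexing,
`π̂₁Mᵢ` is conjugate to `π̂₁Nᵢ` for each `i`."  Vendored in the special case `N = #ᵏ(S¹ × S²)`
(`n = 0`, `s = k`), whence `M ≅ #ᵏ(S¹ × S²)` and `π₁M ≅ F_k` (Hempel (1976), Ch. 3), and with the
hypothesis `π̂₁M ≅ F̂_k` read as "`π₁M` and `F_k` have the same finite quotients" (equivalent for the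
finitely generated group `π₁M`: Dixon–Formanek–Poland–Ribes (1982); loc. cit., p. 1: "The set of
finite quotients of a group `Γ` is encoded by the profinite completion `Γ̂`").  Statement: for a
compact connected orientable smooth 3-manifold `Y` without boundary (charts in `ℝ³`), a base point
`y` and `k : ℕ`, if for every finite group `Q` there is a surjection `π₁(Y, y) ↠ Q` iff there is a
surjection `F_k ↠ Q`, then `π₁(Y, y)` is free of rank `k` (`IsFreeOfRank`).  Named fact (D-0014);
users take `(h : isFreeOfRank_fundamentalGroup_of_sameFiniteQuotients)`.
[cite: WiltonZalesskii2019, Thm. A (Introduction) = Thm. 2.2 (§2, Profinite Kneser–Milnor)]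
[cite: DixonFormanekPolandRibes1982, Thm. (finitely generated groups: same finite quotients iff isomorphic profinite completions)]
[cite: Hempel1976, Ch. 3 (π₁ of a connected sum; π₁(#ᵏ S¹ × S²) = F_k)] -/
def isFreeOfRank_fundamentalGroup_of_sameFiniteQuotients : Prop :=
  ∀ (k : ℕ) (Y : Type u) [TopologicalSpace Y] [T2Space Y] [SecondCountableTopology Y]
    [ChartedSpace (EuclideanSpace ℝ (Fin 3)) Y] [IsManifold (𝓡 3) ∞ Y] [CompactSpace Y]
    [ConnectedSpace Y] (_ : IsOrientable (𝓡 3) Y) (y : Y),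
    (∀ (Q : Type) [Group Q] [Finite Q],
      (∃ f : FundamentalGroup Y y →* Q, Function.Surjective f) ↔
        (∃ f : FreeGroup (Fin k) →* Q, Function.Surjective f)) →
    IsFreeOfRank (FundamentalGroup Y y) k

-- TODO(general form): Wilton–Zalesskii Thm. A for two arbitrary closed orientable 3-manifolds
-- (equality of the numbers of irreducible and of `S¹ × S²` summands, profinite matching of the
-- irreducible summands) and Thm. B (JSJ) need prime-decomposition / JSJ vocabulary for 3-manifolds.

/-- **Heegaard-splitting groups are closed 3-manifold groups** (Jaco 1969 = Hempel (1976),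
Lemma 14.5, with Lemma 14.4).  Print, Lemma 14.5: for a closed orientable surface `T` of genus `g`,
every homomorphism `φ₁ × φ₂ : π₁(T) → F_g × F_g` with `φ₁`, `φ₂` epimorphisms is equivalent to the
splitting homomorphism associated with a Heegaard splitting `(M; U, V)` of some closed orientable
3-manifold `M` (each `φᵢ` is induced by a handlebody bounded by `T`: Leininger–Reid (2002),
Lemma 2.2); Lemma 14.4 (Seifert–van Kampen): `π₁(M) ≅ π₁(T) ⧸ ⟪ker φ₁ ∪ ker φ₂⟫`.  Vendored with the
splitting forgotten, in the kernel vocabulary of `GroupTrisections.lean`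
(`S_g = π₁(Σ_g) = ⟨a₁, b₁, …, a_g, b_g ∣ ∏[aᵢ, bᵢ]⟩`, Hatcher p. 51): for subgroups `K₁, K₂` of `S_g`
whose normal closures have quotients `S_g ⧸ ⟪Kᵢ⟫` free of rank `g` (so that
`S_g ↠ S_g ⧸ ⟪Kᵢ⟫ ≅ F_g` are two epimorphisms onto `F_g`), there are a compact connected orientable
smooth 3-manifold `Y` without boundary (charts in `ℝ³`) and a base point `y` with
`π₁(Y, y) ≅ S_g ⧸ ⟪K₁ ∪ K₂⟫`.  (The strong form with the splitting `Y = H₁ ∪_f H₂`, its gluing data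
and a marking of the Heegaard surface exposed is the statement `JacoPairRealization` of route
`CongruenceShadows`, item `WaldhausenPairs`, line `jaco-splitting-homomorphism`; this is its
composite with van Kampen.)  Named fact (D-0014); users take
`(h : exists_closedThreeManifold_fundamentalGroup_pairQuotient)`.
[cite: Hempel1976, Lemma 14.5 and Lemma 14.4] [cite: Jaco1969] [cite: LeiningerReid2002, Lemma 2.2]
[cite: HatcherAT2002, Thm. 1.20 and p. 51] -/
def exists_closedThreeManifold_fundamentalGroup_pairQuotient : Prop :=
  ∀ (g : ℕ) (K₁ K₂ : Subgroup (SurfaceGroup g)),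
    IsFreeOfRank (SurfaceGroup g ⧸ normalClosure (K₁ : Set (SurfaceGroup g))) g →
    IsFreeOfRank (SurfaceGroup g ⧸ normalClosure (K₂ : Set (SurfaceGroup g))) g →
    ∃ (Y : Type u) (_ : TopologicalSpace Y) (_ : T2Space Y) (_ : SecondCountableTopology Y)
      (_ : ChartedSpace (EuclideanSpace ℝ (Fin 3)) Y) (_ : IsManifold (𝓡 3) ∞ Y)
      (_ : CompactSpace Y) (_ : ConnectedSpace Y) (_ : IsOrientable (𝓡 3) Y) (y : Y),
      Nonempty (FundamentalGroup Y y ≃*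
        SurfaceGroup g ⧸ normalClosure ((K₁ : Set (SurfaceGroup g)) ∪ K₂))

-- TODO(general form): expose the Heegaard splitting (`IsHandlebody g Hᵢ`, `BoundaryData`,
-- `IsBoundaryGluingWith b₁ b₂ f (𝓡 3) j₁ j₂`) and a marking `μ : S_g ≃* π₁(∂H₁, x)` reading
-- `(⟪K₁⟫, ⟪K₂⟫)` as `(ker π₁(incl₁), ker π₁(incl₂ ∘ f))`, as Hempel's Lemma 14.5 does.

/-! ### The group-theoretic corollary consumed by the route -/

/-- **Profinite detection of freeness for Heegaard-splitting groups** (proved from the two named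
facts): let `K₁, K₂ ≤ S_g` have quotients `S_g ⧸ ⟪K₁⟫`, `S_g ⧸ ⟪K₂⟫` free of rank `g`.  If the pair
quotient `S_g ⧸ ⟪K₁ ∪ K₂⟫` has exactly the finite quotients of `F_k` — for every finite group `Q`,
`S_g ⧸ ⟪K₁ ∪ K₂⟫ ↠ Q` exists iff `F_k ↠ Q` exists — then `S_g ⧸ ⟪K₁ ∪ K₂⟫ ≅ F_k`.  Proof: the pair
quotient is `π₁(Y, y)` of a closed orientable 3-manifold
(`exists_closedThreeManifold_fundamentalGroup_pairQuotient`); transport the hypothesis along the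
isomorphism, apply `isFreeOfRank_fundamentalGroup_of_sameFiniteQuotients`, transport back.
[cite: WiltonZalesskii2019, Thm. A] -/
theorem isFreeOfRank_pairQuotient_of_sameFiniteQuotients
    (h₁ : isFreeOfRank_fundamentalGroup_of_sameFiniteQuotients.{u})
    (h₂ : exists_closedThreeManifold_fundamentalGroup_pairQuotient.{u})
    (g k : ℕ) (K₁ K₂ : Subgroup (SurfaceGroup g))
    (hK₁ : IsFreeOfRank (SurfaceGroup g ⧸ normalClosure (K₁ : Set (SurfaceGroup g))) g)
    (hK₂ : IsFreeOfRank (SurfaceGroup g ⧸ normalClosure (K₂ : Set (SurfaceGroup g))) g)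
    (hQ : ∀ (Q : Type) [Group Q] [Finite Q],
      (∃ f : SurfaceGroup g ⧸ normalClosure ((K₁ : Set (SurfaceGroup g)) ∪ K₂) →* Q,
          Function.Surjective f) ↔
        (∃ f : FreeGroup (Fin k) →* Q, Function.Surjective f)) :
    IsFreeOfRank (SurfaceGroup g ⧸ normalClosure ((K₁ : Set (SurfaceGroup g)) ∪ K₂)) k := by
  obtain ⟨Y, _, _, _, _, _, _, _, hY, y, ⟨e⟩⟩ := h₂ g K₁ K₂ hK₁ hK₂
  have hQ' : ∀ (Q : Type) [Group Q] [Finite Q],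
      (∃ f : FundamentalGroup Y y →* Q, Function.Surjective f) ↔
        (∃ f : FreeGroup (Fin k) →* Q, Function.Surjective f) := fun Q _ _ =>
    (exists_surjective_monoidHom_iff_of_mulEquiv e).trans (hQ Q)
  exact (h₁ k Y hY y hQ').of_mulEquiv e

/-! ### Rank detection by finite quotients (appended; step "`r = r'`" of the printed proof)

The last sentence of the proof of Wilton–Zalesskii, Thm. 2.2 — "we see that `F̂_r ≅ F̂_{r'}` and
hence `r = r'`" — in the finite-quotient language of this file and PROVED: free groups of different
ranks are told apart by their elementary abelian `2`-quotients.  This is the part of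
`isFreeOfRank_fundamentalGroup_of_sameFiniteQuotients` that is pure group theory: once `π₁(Y, y)`
is known to be free of SOME rank (the topological content: Kneser–Milnor + Cor. 1.13 of the source),
`IsFreeOfRank.of_sameFiniteQuotients` pins the rank to `k`.  No new named facts (D-0026). -/

/-- `F_r` surjects onto the elementary abelian `2`-group `(ℤ/2)^r` (send `xᵢ ↦ eᵢ`). [folklore] -/
theorem exists_surjective_freeGroup_elementaryTwo (r : ℕ) :
    ∃ f : FreeGroup (Fin r) →* Multiplicative (Fin r → ZMod 2), Function.Surjective f := by
  refine ⟨FreeGroup.lift fun i =>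
    Multiplicative.ofAdd (Pi.single i (1 : ZMod 2) : Fin r → ZMod 2), ?_⟩
  rw [← MonoidHom.range_eq_top, eq_top_iff]
  rintro x -
  have hx : x = ∏ i, Multiplicative.ofAdd (Pi.single i (Multiplicative.toAdd x i)) := by
    rw [← ofAdd_sum, Finset.univ_sum_single]
    rfl
  rw [hx]
  refine Subgroup.prod_mem _ fun i _ => ?_
  have hi : Multiplicative.ofAdd (Pi.single i (Multiplicative.toAdd x i)) =
      Multiplicative.ofAdd (Pi.single i (1 : ZMod 2) : Fin r → ZMod 2) ^
        (Multiplicative.toAdd x i).val := by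
    rw [← ofAdd_nsmul, ← Pi.single_smul, nsmul_eq_mul, mul_one, ZMod.natCast_zmod_val]
  rw [hi]
  exact Subgroup.pow_mem _ (MonoidHom.mem_range.2 ⟨FreeGroup.of i, FreeGroup.lift_apply_of⟩) _

/-- If `F_k` surjects onto `(ℤ/2)^r` then `r ≤ k`: the image is generated by the `k` images of the
free generators, and `k` elements of an elementary abelian `2`-group generate at most `2^k`
elements. [folklore] -/
theorem le_of_surjective_freeGroup_elementaryTwo {k r : ℕ}
    (f : FreeGroup (Fin k) →* Multiplicative (Fin r → ZMod 2)) (hf : Function.Surjective f) :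
    r ≤ k := by
  -- the additive map `(ℤ/2)^k → (ℤ/2)^r`, `c ↦ ∑ cᵢ • f(xᵢ)`
  let v : Fin k → (Fin r → ZMod 2) := fun i => Multiplicative.toAdd (f (FreeGroup.of i))
  let g : (Fin k → ZMod 2) →+ (Fin r → ZMod 2) :=
    { toFun := fun c => ∑ i, c i • v i
      map_zero' := by simp [zero_smul]
      map_add' := fun a b => by simp [add_smul, Finset.sum_add_distrib] }
  -- every `f x` lies in the range of `g`
  have hrange : ∀ x : FreeGroup (Fin k), Multiplicative.toAdd (f x) ∈ g.range := by
    intro x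
    induction x using FreeGroup.induction_on with
    | C1 => simp
    | of i =>
      refine ⟨Pi.single i 1, ?_⟩
      simp [g, v, Pi.single_apply, ite_smul]
    | inv_of i hi => simpa using g.range.neg_mem hi
    | mul x y hx hy => simpa using g.range.add_mem hx hy
  have hg : Function.Surjective g := by
    intro w
    obtain ⟨x, hx⟩ := hf (Multiplicative.ofAdd w)
    obtain ⟨c, hc⟩ := hrange x
    exact ⟨c, by rw [hc, hx]; rfl⟩
  have hcard := Fintype.card_le_of_surjective g hg
  simp only [Fintype.card_pi, ZMod.card, Finset.prod_const, Finset.card_univ,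
    Fintype.card_fin] at hcard
  exact (Nat.pow_le_pow_iff_right Nat.one_lt_two).1 hcard

/-- **Free groups of different ranks are distinguished by their finite quotients** (the last step
of the proof of Wilton–Zalesskii, Thm. 2.2: "`F̂_r ≅ F̂_{r'}` and hence `r = r'`"), in the
finite-quotient language of this file: if `G` is free of rank `r` and, for every finite group `Q`,
`G ↠ Q` exists iff `F_k ↠ Q` exists, then `r = k` (test on `Q = (ℤ/2)^r` and `Q = (ℤ/2)^k`).
[cite: WiltonZalesskii2019, §2, proof of Thm. 2.2 (last sentence)] -/
theorem IsFreeOfRank.rank_eq_of_sameFiniteQuotients {G : Type*} [Group G] {r k : ℕ}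
    (hG : IsFreeOfRank G r)
    (hQ : ∀ (Q : Type) [Group Q] [Finite Q],
      (∃ f : G →* Q, Function.Surjective f) ↔
        (∃ f : FreeGroup (Fin k) →* Q, Function.Surjective f)) :
    r = k := by
  obtain ⟨e⟩ := hG
  refine le_antisymm ?_ ?_
  · obtain ⟨f, hf⟩ := exists_surjective_freeGroup_elementaryTwo r
    obtain ⟨f', hf'⟩ := (hQ (Multiplicative (Fin r → ZMod 2))).1
      ⟨f.comp e.symm.toMonoidHom, hf.comp e.symm.surjective⟩
    exact le_of_surjective_freeGroup_elementaryTwo f' hf'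
  · obtain ⟨f, hf⟩ := exists_surjective_freeGroup_elementaryTwo k
    obtain ⟨f', hf'⟩ := (hQ (Multiplicative (Fin k → ZMod 2))).2 ⟨f, hf⟩
    exact le_of_surjective_freeGroup_elementaryTwo (f'.comp e.toMonoidHom)
      (hf'.comp e.surjective)

/-- **Rank detection by finite quotients**: a group free of some rank `r` with exactly the finite
quotients of `F_k` is free of rank `k`.  This is what remains of Wilton–Zalesskii Thm. A for
`#ᵏ(S¹ × S²)` once the fundamental group is known to be free (step "`r = r'`" of the printed
proof). [cite: WiltonZalesskii2019, §2, proof of Thm. 2.2 (last sentence)] -/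
theorem IsFreeOfRank.of_sameFiniteQuotients {G : Type*} [Group G] {r k : ℕ}
    (hG : IsFreeOfRank G r)
    (hQ : ∀ (Q : Type) [Group Q] [Finite Q],
      (∃ f : G →* Q, Function.Surjective f) ↔
        (∃ f : FreeGroup (Fin k) →* Q, Function.Surjective f)) :
    IsFreeOfRank G k :=
  hG.rank_eq_of_sameFiniteQuotients hQ ▸ hG

/-! ### Counting homomorphisms into finite groups (appended; the hypothesis at finite level)

The printed proof reads the hypothesis "`π₁Y` has the finite quotients of `F_k`" as `π̂₁Y ≅ F̂_k`
(Dixon–Formanek–Poland–Ribes 1982, for the finitely generated group `π₁Y`).  Without building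
profinite completions, the finite-level content of that translation is PROVED here by an elementary
count: if every finite quotient of `G` is a quotient of `G'`, then `G` has at most as many
homomorphisms into each finite group `Q` as `G'` (push `N` distinct maps `G → Q` through the finite
image of their product `G → Q^N`, a finite quotient of `G`, hence of `G'`); so groups with the same
finite quotients have the same `|Hom(–, Q)|` for every finite `Q`, and a group with the finite
quotients of `F_k` has exactly `|Q|^k` homomorphisms into `Q` — with no finite-generation
hypothesis (finite `Q` in any universe: a finite quotient is shrunk into `Type` first).  Then the
key lemma of Dixon–Formanek–Poland–Ribes at finite level ("`G/G(n) ≅ H/H(n)`", loc. cit., Lemma 3,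
here with the `Q`-residual `⋂_{f : G → Q} ker f` in place of `G(n)`): the largest residually-`Q`
quotients of `G` and `G'` are isomorphic, each being a finite quotient of the other group that
kills its `Q`-residual.  No new named facts (D-0026). -/

section CountingHoms

variable {G G' : Type*} [Group G] [Group G']

/-- The hypothesis "every finite quotient of `G` in `Type` is a quotient of `G'`" covers finite
quotients of `G` in every universe (shrink the finite group into `Type`). [folklore] -/
theorem exists_surjective_of_finiteQuotients
    (h : ∀ (Q : Type) [Group Q] [Finite Q],
      (∃ f : G →* Q, Function.Surjective f) → (∃ f : G' →* Q, Function.Surjective f))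
    {P : Type*} [Group P] [Finite P] (π : G →* P) (hπ : Function.Surjective π) :
    ∃ σ : G' →* P, Function.Surjective σ := by
  haveI hs : Small.{0} P := inferInstance
  haveI : Finite (Shrink.{0} P) := Finite.of_equiv P (@equivShrink P hs)
  let e : Shrink.{0} P ≃* P := @Shrink.mulEquiv P hs _
  obtain ⟨σ, hσ⟩ := h (Shrink.{0} P) ⟨e.symm.toMonoidHom.comp π, e.symm.surjective.comp hπ⟩
  exact ⟨e.toMonoidHom.comp σ, e.surjective.comp hσ⟩

/-- **Finite quotients bound homomorphism counts.**  If every finite quotient of `G` is a quotient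
of `G'`, then `N` pairwise distinct homomorphisms `G → Q` into a finite group `Q` give `N` pairwise
distinct homomorphisms `G' → Q`: push them through the finite image `P ≤ Q^N` of their product,
which is a finite quotient of `G` and hence of `G'`.  (The finite-level content of
Dixon–Formanek–Poland–Ribes: finitely generated groups with the same finite quotients have
isomorphic profinite completions.)
[cite: DixonFormanekPolandRibes1982, Thm. 1 and Remark 1 (type (F_𝒱): finitely many homomorphisms into each finite group)] -/
theorem le_card_monoidHom_of_finiteQuotients
    (h : ∀ (Q : Type) [Group Q] [Finite Q],
      (∃ f : G →* Q, Function.Surjective f) → (∃ f : G' →* Q, Function.Surjective f))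
    {Q : Type*} [Group Q] [Finite Q] [Finite (G' →* Q)] {N : ℕ} (φ : Fin N → (G →* Q))
    (hφ : Function.Injective φ) : N ≤ Nat.card (G' →* Q) := by
  -- the product homomorphism and its (finite) image, a finite quotient of `G`, hence of `G'`
  let Φ : G →* (Fin N → Q) := MonoidHom.pi φ
  obtain ⟨σ, hσ⟩ :=
    exists_surjective_of_finiteQuotients h Φ.rangeRestrict Φ.rangeRestrict_surjective
  -- the coordinate projections of the image
  let p : Fin N → (Φ.range →* Q) := fun i => (Pi.evalMonoidHom (fun _ => Q) i).comp Φ.range.subtype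
  have hp : ∀ i, (p i).comp Φ.rangeRestrict = φ i := fun i => MonoidHom.ext fun g => rfl
  -- precomposed with `σ : G' ↠ P` they stay pairwise distinct
  have hinj : Function.Injective fun i => (p i).comp σ := by
    intro i j hij
    apply hφ
    have hpij : p i = p j :=
      MonoidHom.ext fun x => by
        obtain ⟨y, rfl⟩ := hσ x
        exact DFunLike.congr_fun hij y
    rw [← hp i, ← hp j, hpij]
  simpa using Nat.card_le_card_of_injective _ hinj

/-- If every finite quotient of `G` is a quotient of `G'` and `G'` has finitely many homomorphisms
into the finite group `Q`, then so does `G`.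
[cite: DixonFormanekPolandRibes1982, Thm. (finitely generated groups: same finite quotients iff isomorphic profinite completions)] -/
theorem finite_monoidHom_of_finiteQuotients
    (h : ∀ (Q : Type) [Group Q] [Finite Q],
      (∃ f : G →* Q, Function.Surjective f) → (∃ f : G' →* Q, Function.Surjective f))
    (Q : Type*) [Group Q] [Finite Q] [Finite (G' →* Q)] : Finite (G →* Q) := by
  by_contra hinf
  rw [not_finite_iff_infinite] at hinf
  have emb := Infinite.natEmbedding (G →* Q)
  have := le_card_monoidHom_of_finiteQuotients h
    (fun i : Fin (Nat.card (G' →* Q) + 1) => emb i) (emb.injective.comp Fin.val_injective)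
  omega

/-- If every finite quotient of `G` is a quotient of `G'`, then `G` has at most as many
homomorphisms into any finite group `Q` as `G'` (when the latter number is finite).
[cite: DixonFormanekPolandRibes1982, Thm. (finitely generated groups: same finite quotients iff isomorphic profinite completions)] -/
theorem card_monoidHom_le_of_finiteQuotients
    (h : ∀ (Q : Type) [Group Q] [Finite Q],
      (∃ f : G →* Q, Function.Surjective f) → (∃ f : G' →* Q, Function.Surjective f))
    (Q : Type*) [Group Q] [Finite Q] [Finite (G' →* Q)] :
    Nat.card (G →* Q) ≤ Nat.card (G' →* Q) := by
  haveI := finite_monoidHom_of_finiteQuotients h Q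
  exact le_card_monoidHom_of_finiteQuotients h (Finite.equivFin (G →* Q)).symm
    (Finite.equivFin (G →* Q)).symm.injective

/-- **Groups with the same finite quotients have the same number of homomorphisms into every
finite group** (as soon as one of the two numbers is finite) — Dixon–Formanek–Poland–Ribes at
finite level.
[cite: DixonFormanekPolandRibes1982, Thm. (finitely generated groups: same finite quotients iff isomorphic profinite completions)] -/
theorem card_monoidHom_eq_of_sameFiniteQuotients
    (h : ∀ (Q : Type) [Group Q] [Finite Q],
      (∃ f : G →* Q, Function.Surjective f) ↔ (∃ f : G' →* Q, Function.Surjective f))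
    (Q : Type*) [Group Q] [Finite Q] [Finite (G' →* Q)] :
    Nat.card (G →* Q) = Nat.card (G' →* Q) := by
  haveI := finite_monoidHom_of_finiteQuotients (fun Q _ _ => (h Q).1) Q
  exact le_antisymm (card_monoidHom_le_of_finiteQuotients (fun Q _ _ => (h Q).1) Q)
    (card_monoidHom_le_of_finiteQuotients (fun Q _ _ => (h Q).2) Q)

/-- `F_k` has `|Q|^k` homomorphisms into a finite group `Q`. [folklore] -/
theorem card_monoidHom_freeGroup (k : ℕ) (Q : Type*) [Group Q] [Finite Q] :
    Nat.card (FreeGroup (Fin k) →* Q) = Nat.card Q ^ k := by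
  rw [Nat.card_congr FreeGroup.lift.symm, Nat.card_fun, Nat.card_fin]

/-- `F_k` has finitely many homomorphisms into a finite group (`Hom(F_k, Q) ≃ Q^k`). [folklore] -/
instance finite_monoidHom_freeGroup (k : ℕ) (Q : Type*) [Group Q] [Finite Q] :
    Finite (FreeGroup (Fin k) →* Q) :=
  Finite.of_equiv _ FreeGroup.lift

/-- **A group with exactly the finite quotients of `F_k` has exactly `|Q|^k` homomorphisms into
every finite group `Q`** (in particular finitely many): the hypothesis of
`isFreeOfRank_fundamentalGroup_of_sameFiniteQuotients` in the quantitative form in which the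
printed proof uses it (`π̂₁Y ≅ F̂_k`, via Dixon–Formanek–Poland–Ribes).
[cite: DixonFormanekPolandRibes1982, Thm. (finitely generated groups: same finite quotients iff isomorphic profinite completions)]
[cite: WiltonZalesskii2019, §2, Thm. 2.2 (hypothesis `π̂₁M ≅ π̂₁M'`)] -/
theorem card_monoidHom_eq_of_sameFiniteQuotients_freeGroup {k : ℕ}
    (hQ : ∀ (Q : Type) [Group Q] [Finite Q],
      (∃ f : G →* Q, Function.Surjective f) ↔
        (∃ f : FreeGroup (Fin k) →* Q, Function.Surjective f))
    (Q : Type*) [Group Q] [Finite Q] :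
    Finite (G →* Q) ∧ Nat.card (G →* Q) = Nat.card Q ^ k :=
  ⟨finite_monoidHom_of_finiteQuotients (fun Q _ _ => (hQ Q).1) Q,
    (card_monoidHom_eq_of_sameFiniteQuotients hQ Q).trans (card_monoidHom_freeGroup k Q)⟩

/-! #### Characteristic finite quotients agree -/

/-- The kernel of the canonical map `G → Q^{Hom(G, Q)}`, `g ↦ (f ↦ f g)`, is the intersection of
the kernels of all homomorphisms `G → Q` (the `Q`-residual of `G`). [folklore] -/
theorem ker_pi_monoidHom_eq_iInf (Q : Type*) [Group Q] :
    (MonoidHom.pi fun f : G →* Q => f).ker = ⨅ f : G →* Q, f.ker := by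
  ext x
  simp only [MonoidHom.mem_ker, Subgroup.mem_iInf, funext_iff, MonoidHom.pi_apply, Pi.one_apply]

/-- If every finite quotient of `G` is a quotient of `G'` (and `G'` has finitely many
homomorphisms into the finite group `Q`), the image of `G' → Q^{Hom(G', Q)}` surjects onto the
image of `G → Q^{Hom(G, Q)}`: a surjection `σ : G' ↠ im(G)` kills the `Q`-residual of `G'`,
because each coordinate of `σ` is a homomorphism `G' → Q`.
[cite: DixonFormanekPolandRibes1982, Lemma 3 (G/G(n) ≅ H/H(n)) and Thm. 1] -/
theorem exists_surjective_range_pi_of_finiteQuotients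
    (h : ∀ (Q : Type) [Group Q] [Finite Q],
      (∃ f : G →* Q, Function.Surjective f) → (∃ f : G' →* Q, Function.Surjective f))
    (Q : Type*) [Group Q] [Finite Q] [Finite (G' →* Q)] :
    ∃ τ : (MonoidHom.pi fun f : G' →* Q => f).range →* (MonoidHom.pi fun f : G →* Q => f).range,
      Function.Surjective τ := by
  haveI : Finite (G →* Q) := finite_monoidHom_of_finiteQuotients h Q
  set Φ : G →* (G →* Q) → Q := MonoidHom.pi fun f : G →* Q => f
  set Φ' : G' →* (G' →* Q) → Q := MonoidHom.pi fun f : G' →* Q => f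
  obtain ⟨σ, hσ⟩ :=
    exists_surjective_of_finiteQuotients h Φ.rangeRestrict Φ.rangeRestrict_surjective
  have hker : Φ'.rangeRestrict.ker ≤ σ.ker := by
    intro x hx
    rw [MonoidHom.mem_ker] at hx ⊢
    have hx' : ∀ f' : G' →* Q, f' x = 1 := fun f' => by
      have := congrArg (fun y : Φ'.range => (y : (G' →* Q) → Q) f') hx
      simpa [Φ'] using this
    refine Subtype.ext (funext fun f => ?_)
    exact hx' ((Pi.evalMonoidHom (fun _ => Q) f).comp (Φ.range.subtype.comp σ))
  refine ⟨Φ'.rangeRestrict.liftOfSurjective Φ'.rangeRestrict_surjective ⟨σ, hker⟩, ?_⟩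
  have hcomp : (Φ'.rangeRestrict.liftOfSurjective Φ'.rangeRestrict_surjective ⟨σ, hker⟩).comp
      Φ'.rangeRestrict = σ :=
    Φ'.rangeRestrict.liftOfRightInverse_comp _ _ ⟨σ, hker⟩
  refine Function.Surjective.of_comp (g := Φ'.rangeRestrict) ?_
  rw [← MonoidHom.coe_comp, hcomp]
  exact hσ

/-- **Characteristic finite quotients agree** (the key finite-level step of
Dixon–Formanek–Poland–Ribes): if `G` and `G'` have the same finite quotients and finitely many
homomorphisms into the finite group `Q`, then the images of `G → Q^{Hom(G, Q)}` and
`G' → Q^{Hom(G', Q)}` — the largest residually-`Q` quotients `G ⧸ ⋂ ker`, `G' ⧸ ⋂ ker` — are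
isomorphic: each surjects onto the other and both are finite.
[cite: DixonFormanekPolandRibes1982, Lemma 3 (G/G(n) ≅ H/H(n)) and Thm. 1] -/
theorem nonempty_range_pi_mulEquiv_of_sameFiniteQuotients
    (h : ∀ (Q : Type) [Group Q] [Finite Q],
      (∃ f : G →* Q, Function.Surjective f) ↔ (∃ f : G' →* Q, Function.Surjective f))
    (Q : Type*) [Group Q] [Finite Q] [Finite (G' →* Q)] :
    Nonempty ((MonoidHom.pi fun f : G →* Q => f).range ≃*
      (MonoidHom.pi fun f : G' →* Q => f).range) := by
  haveI : Finite (G →* Q) := finite_monoidHom_of_finiteQuotients (fun Q _ _ => (h Q).1) Q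
  obtain ⟨τ, hτ⟩ := exists_surjective_range_pi_of_finiteQuotients (fun Q _ _ => (h Q).1) Q
  obtain ⟨τ', hτ'⟩ := exists_surjective_range_pi_of_finiteQuotients (fun Q _ _ => (h Q).2) Q
  exact ⟨MulEquiv.ofBijective τ'
    (hτ'.bijective_of_nat_card_le (Nat.card_le_card_of_surjective _ hτ))⟩

/-- The `Q`-residual `⋂_{f : G → Q} ker f` is a normal subgroup. [folklore] -/
instance normal_iInf_ker_monoidHom (Q : Type*) [Group Q] : (⨅ f : G →* Q, f.ker).Normal :=
  Subgroup.normal_iInf_normal fun _ => inferInstance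

/-- **Dixon–Formanek–Poland–Ribes at finite level, quotient form**: groups with the same finite
quotients (and finitely many homomorphisms into the finite group `Q`) have isomorphic largest
residually-`Q` quotients `G ⧸ ⋂_{f : G → Q} ker f ≅ G' ⧸ ⋂_{f : G' → Q} ker f`.
[cite: DixonFormanekPolandRibes1982, Lemma 3 (G/G(n) ≅ H/H(n)) and Thm. 1] -/
theorem nonempty_quotient_iInf_ker_mulEquiv_of_sameFiniteQuotients
    (h : ∀ (Q : Type) [Group Q] [Finite Q],
      (∃ f : G →* Q, Function.Surjective f) ↔ (∃ f : G' →* Q, Function.Surjective f))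
    (Q : Type*) [Group Q] [Finite Q] [Finite (G' →* Q)] :
    Nonempty ((G ⧸ ⨅ f : G →* Q, f.ker) ≃* (G' ⧸ ⨅ f : G' →* Q, f.ker)) := by
  obtain ⟨e⟩ := nonempty_range_pi_mulEquiv_of_sameFiniteQuotients h Q
  have eG : (G ⧸ ⨅ f : G →* Q, f.ker) ≃* (MonoidHom.pi fun f : G →* Q => f).range :=
    (QuotientGroup.quotientMulEquivOfEq (ker_pi_monoidHom_eq_iInf Q).symm).trans
      (QuotientGroup.quotientKerEquivRange _)
  have eG' : (G' ⧸ ⨅ f : G' →* Q, f.ker) ≃* (MonoidHom.pi fun f : G' →* Q => f).range :=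
    (QuotientGroup.quotientMulEquivOfEq (ker_pi_monoidHom_eq_iInf Q).symm).trans
      (QuotientGroup.quotientKerEquivRange _)
  exact ⟨eG.trans (e.trans eG'.symm)⟩

/-- **A group with the finite quotients of `F_k` has the characteristic finite quotients of
`F_k`**: for every finite group `Q`, `G ⧸ ⋂_{f : G → Q} ker f ≅ F_k ⧸ ⋂_{f : F_k → Q} ker f` — the
finite shadows of "`Ĝ ≅ F̂_k`" used by the printed proof.
[cite: DixonFormanekPolandRibes1982, Thm. (finitely generated groups: same finite quotients iff isomorphic profinite completions)]
[cite: WiltonZalesskii2019, §2, Thm. 2.2 (hypothesis `π̂₁M ≅ π̂₁M'`)] -/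
theorem nonempty_quotient_iInf_ker_mulEquiv_freeGroup_of_sameFiniteQuotients {k : ℕ}
    (hQ : ∀ (Q : Type) [Group Q] [Finite Q],
      (∃ f : G →* Q, Function.Surjective f) ↔
        (∃ f : FreeGroup (Fin k) →* Q, Function.Surjective f))
    (Q : Type*) [Group Q] [Finite Q] :
    Nonempty ((G ⧸ ⨅ f : G →* Q, f.ker) ≃*
      (FreeGroup (Fin k) ⧸ ⨅ f : FreeGroup (Fin k) →* Q, f.ker)) :=
  nonempty_quotient_iInf_ker_mulEquiv_of_sameFiniteQuotients hQ Q

end CountingHoms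

/-! ### Finite embedding problems and torsion (appended; the finite shadow of "`F̂_k` is projective")

In the printed proof of Wilton–Zalesskii, Thm. 2.2 (via Cor. 1.13, finite case: a finite group acting
on a profinite tree fixes a vertex) a Kneser–Milnor summand `N_i` of `M` with FINITE fundamental
group is excluded because `π̂₁N_i = π₁N_i` would be a non-trivial finite subgroup of the free — hence
projective, hence torsion-free — profinite group `π̂₁M ≅ F̂_k`.  The finite-level content of that
step is PROVED here, without profinite completions, from the characteristic quotients of the previous
section: a group `G` with the finite quotients of `F_k` solves every finite embedding problem weakly
(every `G → P`, `P` finite, lifts through every finite `E ↠ P`: lift on `F_k` and transport through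
`G ⧸ R_{E×P}(G) ≅ F_k ⧸ R_{E×P}(F_k)`); consequently every element of finite order of `G` dies in
every finite cyclic — hence every finite abelian — quotient of `G` (lift `G → ℤ/n` through
`ℤ/Nn ↠ ℤ/n`, `N` the order), and every finite retract of `G` (e.g. a finite free factor,
`π₁` of a connected summand, Hempel (1976), Ch. 3) is perfect.  So abelian finite quotients already
exclude every finite summand group with `H₁ ≠ 0`; the perfect finite case and the aspherical
summands are the cohomological half of Cor. 1.13 (goodness, profinite `PD³`), not formalised here.
No new named facts (D-0026). -/

section EmbeddingProblems

variable {G : Type*} [Group G] {k : ℕ}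

/-- **Finite embedding problems are weakly solvable for a group with the finite quotients of a free
group** (the finite shadow of "`Ĝ ≅ F̂_k` is a projective profinite group"): if `G` has exactly the
finite quotients of `F_k`, then every homomorphism `π : G → P` to a finite group lifts through every
surjection `ε : E ↠ P` of finite groups, `ε ∘ f = π`.  Proof: with `Q = E × P`, transport `π` through
the isomorphic characteristic quotients `G ⧸ R_Q(G) ≅ F_k ⧸ R_Q(F_k)`
(`nonempty_quotient_iInf_ker_mulEquiv_freeGroup_of_sameFiniteQuotients`), lift on the free group,
and come back.  (Finite-level form of: the free profinite group `F̂_k` is projective.) [folklore] -/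
theorem exists_monoidHom_comp_eq_of_sameFiniteQuotients_freeGroup
    (hQ : ∀ (Q : Type) [Group Q] [Finite Q],
      (∃ f : G →* Q, Function.Surjective f) ↔
        (∃ f : FreeGroup (Fin k) →* Q, Function.Surjective f))
    {P E : Type*} [Group P] [Finite P] [Group E] [Finite E] (π : G →* P) (ε : E →* P)
    (hε : Function.Surjective ε) : ∃ f : G →* E, ε.comp f = π := by
  classical
  obtain ⟨θ⟩ := nonempty_quotient_iInf_ker_mulEquiv_freeGroup_of_sameFiniteQuotients hQ (E × P)
  -- `π` factors through the characteristic quotient of `G`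
  have hπ : (⨅ f : G →* E × P, f.ker) ≤ π.ker := fun x hx => by
    have h := (Subgroup.mem_iInf.1 hx) ((MonoidHom.inr E P).comp π)
    rw [MonoidHom.mem_ker, MonoidHom.comp_apply, MonoidHom.inr_apply, Prod.mk_eq_one] at h
    exact h.2
  set πbar : (G ⧸ ⨅ f : G →* E × P, f.ker) →* P := QuotientGroup.lift _ π hπ with hπbar
  -- the induced map on the free group and its lift through `ε`
  set ψ : FreeGroup (Fin k) →* P :=
    πbar.comp (θ.symm.toMonoidHom.comp (QuotientGroup.mk' (⨅ f : FreeGroup (Fin k) →* E × P, f.ker)))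
    with hψ
  set ψt : FreeGroup (Fin k) →* E := FreeGroup.lift fun i => surjInv hε (ψ (FreeGroup.of i)) with hψt
  have hεψt : ε.comp ψt = ψ :=
    FreeGroup.ext_hom _ _ fun i => by
      rw [MonoidHom.comp_apply, hψt, FreeGroup.lift_apply_of, surjInv_eq hε]
  -- the lift factors through the characteristic quotient of `F_k`
  have hψt_ker : (⨅ f : FreeGroup (Fin k) →* E × P, f.ker) ≤ ψt.ker := fun w hw => by
    have h := (Subgroup.mem_iInf.1 hw) ((MonoidHom.inl E P).comp ψt)
    rw [MonoidHom.mem_ker, MonoidHom.comp_apply, MonoidHom.inl_apply, Prod.mk_eq_one] at h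
    exact h.1
  set ψtbar : (FreeGroup (Fin k) ⧸ ⨅ f : FreeGroup (Fin k) →* E × P, f.ker) →* E :=
    QuotientGroup.lift _ ψt hψt_ker with hψtbar
  refine ⟨ψtbar.comp (θ.toMonoidHom.comp (QuotientGroup.mk' _)), MonoidHom.ext fun x => ?_⟩
  obtain ⟨w, hw⟩ := QuotientGroup.mk_surjective (θ (QuotientGroup.mk' _ x))
  have h1 : ε (ψt w) = ψ w := DFunLike.congr_fun hεψt w
  rw [MonoidHom.comp_apply, MonoidHom.comp_apply, MonoidHom.comp_apply, MulEquiv.coe_toMonoidHom,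
    ← hw, hψtbar, QuotientGroup.lift_mk, h1, hψ, MonoidHom.comp_apply, MonoidHom.comp_apply,
    QuotientGroup.mk'_apply, MulEquiv.coe_toMonoidHom, hw, MulEquiv.symm_apply_apply, hπbar,
    QuotientGroup.mk'_apply, QuotientGroup.lift_mk]

/-- **Torsion is invisible in the finite cyclic quotients of a group with the finite quotients of a
free group** (finite shadow of "`F̂_k` is torsion-free"): if `G` has exactly the finite quotients of
`F_k`, every element `g` of finite order `N` lies in the kernel of every homomorphism
`φ : G → ℤ/n` (`n ≥ 1`).  Proof: lift `φ` through `ℤ/Nn ↠ ℤ/n`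
(`exists_monoidHom_comp_eq_of_sameFiniteQuotients_freeGroup`); the image of `g` is an `N`-torsion
element of `ℤ/Nn`, i.e. a multiple of `n`, which reduces to `0`. [folklore] -/
theorem map_eq_one_of_isOfFinOrder_of_sameFiniteQuotients_freeGroup
    (hQ : ∀ (Q : Type) [Group Q] [Finite Q],
      (∃ f : G →* Q, Function.Surjective f) ↔
        (∃ f : FreeGroup (Fin k) →* Q, Function.Surjective f))
    {g : G} (hg : IsOfFinOrder g) {n : ℕ} [NeZero n] (φ : G →* Multiplicative (ZMod n)) :
    φ g = 1 := by
  set N := orderOf g with hN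
  have hN0 : N ≠ 0 := (hg.orderOf_pos).ne'
  haveI : NeZero (N * n) := ⟨Nat.mul_ne_zero hN0 (NeZero.ne n)⟩
  -- the reduction `ℤ/Nn ↠ ℤ/n`
  set ε : Multiplicative (ZMod (N * n)) →* Multiplicative (ZMod n) :=
    AddMonoidHom.toMultiplicative (ZMod.castHom (dvd_mul_left n N) (ZMod n)).toAddMonoidHom with hε
  have hεapp : ∀ a : ℕ, ε (Multiplicative.ofAdd (a : ZMod (N * n))) =
      Multiplicative.ofAdd (a : ZMod n) := fun a => by
    rw [hε, AddMonoidHom.coe_toMultiplicative, comp_apply, comp_apply, toAdd_ofAdd,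
      RingHom.toAddMonoidHom_eq_coe, AddMonoidHom.coe_coe, ZMod.castHom_apply,
      ZMod.cast_natCast (dvd_mul_left n N)]
  have hεs : Function.Surjective ε := fun y => by
    refine ⟨Multiplicative.ofAdd ((Multiplicative.toAdd y).val : ZMod (N * n)), ?_⟩
    rw [hεapp, ZMod.natCast_zmod_val, ofAdd_toAdd]
  obtain ⟨f, hf⟩ := exists_monoidHom_comp_eq_of_sameFiniteQuotients_freeGroup hQ φ ε hεs
  -- `f g` is `N`-torsion in `ℤ/Nn`, hence a multiple of `n`
  have hfg : (f g) ^ N = 1 := by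
    rw [← map_pow]
    exact (congrArg f (pow_orderOf_eq_one (x := g))).trans (map_one f)
  set y : ZMod (N * n) := Multiplicative.toAdd (f g) with hy
  have hyN : (N : ZMod (N * n)) * y = 0 := by
    have := congrArg Multiplicative.toAdd hfg
    rwa [toAdd_pow, toAdd_one, nsmul_eq_mul] at this
  have hdvd : n ∣ y.val := by
    have h1 : ((N * y.val : ℕ) : ZMod (N * n)) = 0 := by
      rw [Nat.cast_mul, ZMod.natCast_zmod_val, hyN]
    have h2 : N * n ∣ N * y.val := (ZMod.natCast_eq_zero_iff _ _).1 h1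
    exact Nat.dvd_of_mul_dvd_mul_left (Nat.pos_of_ne_zero hN0) h2
  -- so `φ g = ε (f g) = 0`
  have hφg : φ g = ε (f g) := by rw [← hf, MonoidHom.comp_apply]
  rw [hφg, ← ofAdd_toAdd (f g), ← hy, ← ZMod.natCast_zmod_val y, hεapp,
    (ZMod.natCast_eq_zero_iff _ _).2 hdvd, ofAdd_zero]

/-- **Torsion is invisible in every finite abelian quotient** of a group with the finite quotients of
a free group: for `g` of finite order and `φ : G → C` with `C` finite abelian, `φ g = 1` (decompose
`C ≅ ∏ ℤ/nᵢ`, `CommGroup.equiv_prod_multiplicative_zmod_of_finite`, and apply the cyclic case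
coordinatewise). [folklore] -/
theorem map_eq_one_of_isOfFinOrder_of_sameFiniteQuotients_freeGroup_of_comm
    (hQ : ∀ (Q : Type) [Group Q] [Finite Q],
      (∃ f : G →* Q, Function.Surjective f) ↔
        (∃ f : FreeGroup (Fin k) →* Q, Function.Surjective f))
    {g : G} (hg : IsOfFinOrder g) {C : Type*} [CommGroup C] [Finite C] (φ : G →* C) : φ g = 1 := by
  obtain ⟨ι, _, n, hn, ⟨e⟩⟩ := CommGroup.equiv_prod_multiplicative_zmod_of_finite C
  apply e.injective
  rw [map_one]
  funext i
  haveI : NeZero (n i) := ⟨(Nat.zero_lt_one.trans (hn i)).ne'⟩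
  exact map_eq_one_of_isOfFinOrder_of_sameFiniteQuotients_freeGroup hQ hg
    ((Pi.evalMonoidHom (fun j => Multiplicative (ZMod (n j))) i).comp (e.toMonoidHom.comp φ))

/-- **A finite retract of a group with the finite quotients of a free group is perfect**: if `G` has
exactly the finite quotients of `F_k` and `A` is a finite retract of `G` (`ρ ∘ s = id`), then
`[A, A] = A` — the abelianisation map `A → A^{ab}` is a homomorphism to a finite abelian group, hence
kills the finite-order elements `a = ρ (s a)`.  (WZ19, Cor. 1.13 / Thm. 2.2 exclude ALL non-trivial
finite free factors, `F̂_k` being torsion-free; at finite level the perfect ones — among finite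
3-manifold groups only the binary icosahedral group `SL(2,5) = π₁` of the Poincaré sphere — are out
of reach of abelian invariants.) [folklore] -/
theorem commutator_eq_top_of_retract_of_sameFiniteQuotients_freeGroup
    (hQ : ∀ (Q : Type) [Group Q] [Finite Q],
      (∃ f : G →* Q, Function.Surjective f) ↔
        (∃ f : FreeGroup (Fin k) →* Q, Function.Surjective f))
    {A : Type*} [Group A] [Finite A] (ρ : G →* A) (s : A →* G) (hρs : ∀ a, ρ (s a) = a) :
    commutator A = ⊤ := by
  rw [← Abelianization.ker_of, eq_top_iff]
  intro a _
  have ha : IsOfFinOrder (s a) := s.isOfFinOrder (isOfFinOrder_of_finite a)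
  have h := map_eq_one_of_isOfFinOrder_of_sameFiniteQuotients_freeGroup_of_comm hQ ha
    (Abelianization.of.comp ρ)
  rwa [MonoidHom.comp_apply, hρs] at h

/-- **A finite free factor of a group with the finite quotients of a free group is perfect**,
free-product form: if `A ∗ B` has exactly the finite quotients of `F_k` and `A` is finite then
`[A, A] = A`.  In the source's language (`π₁(N # M') = π₁N ∗ π₁M'`, Hempel (1976), Ch. 3): a closed
orientable 3-manifold whose group has the finite quotients of `F_k` has no Kneser–Milnor summand with
finite fundamental group and `H₁ ≠ 0` (no lens space, prism manifold, …). [folklore] -/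
theorem commutator_eq_top_of_coprod_sameFiniteQuotients_freeGroup {A B : Type*} [Group A]
    [Finite A] [Group B]
    (hQ : ∀ (Q : Type) [Group Q] [Finite Q],
      (∃ f : Monoid.Coprod A B →* Q, Function.Surjective f) ↔
        (∃ f : FreeGroup (Fin k) →* Q, Function.Surjective f)) :
    commutator A = ⊤ :=
  commutator_eq_top_of_retract_of_sameFiniteQuotients_freeGroup hQ
    (Monoid.Coprod.fst : Monoid.Coprod A B →* A) Monoid.Coprod.inl
    (fun a => Monoid.Coprod.fst_apply_inl a)

end EmbeddingProblems

/-! ### Epimorphisms from `F_k` (appended; Dixon–Formanek–Poland–Ribes Thm. 3 and Jarden's corollary)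

With the Hom-count above and the residual finiteness of free groups
(`Literature.GroupTheory.CombinatorialGroupTheory.freeGroup_residuallyFinite`), Thm. 3 of
Dixon–Formanek–Poland–Ribes for `G = F_k` and its Corollary (Jarden) are PROVED: an epimorphism
`F_k ↠ G` onto a group with the finite quotients of `F_k` is an isomorphism.  For the named fact this
isolates the topological content as "`π₁(Y, y)` is generated by `k` elements" (equivalently, by
`IsFreeOfRank.of_sameFiniteQuotients`, "is free of some rank").  No new named facts (D-0026). -/

section Jarden

variable {G : Type*} [Group G]

/-- **An epimorphism from `F_k` onto a group with the finite quotients of `F_k` is injective**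
(Dixon–Formanek–Poland–Ribes, Thm. 3, for the residually finite group `F_k`).  Proof: precomposition
with the epimorphism `φ` injects `Hom(G, Q)` into `Hom(F_k, Q)`; both are finite of the same size
(`card_monoidHom_eq_of_sameFiniteQuotients_freeGroup`), so every `f : F_k → Q` factors through
`φ`, hence kills `ker φ`; but a non-trivial element of `F_k` survives in some finite symmetric
group (free groups are residually finite, `exists_perm_apply_ne`).
[cite: DixonFormanekPolandRibes1982, Thm. 3 and its Corollary (Jarden)] -/
theorem injective_of_surjective_of_sameFiniteQuotients {k : ℕ} (φ : FreeGroup (Fin k) →* G)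
    (hφ : Function.Surjective φ)
    (hQ : ∀ (Q : Type) [Group Q] [Finite Q],
      (∃ f : G →* Q, Function.Surjective f) ↔
        (∃ f : FreeGroup (Fin k) →* Q, Function.Surjective f)) :
    Function.Injective φ := by
  rw [injective_iff_map_eq_one]
  intro x hx
  by_contra hne
  obtain ⟨n, f₀, hf₀⟩ :=
    Literature.GroupTheory.CombinatorialGroupTheory.exists_perm_apply_ne x hne
  -- precomposition with `φ` is a bijection `Hom(G, Q) → Hom(F_k, Q)`, `Q = Perm (Fin (n+1))`
  have hinj : Function.Injective fun g : G →* Equiv.Perm (Fin (n + 1)) => g.comp φ :=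
    fun g g' h => MonoidHom.ext fun y => by
      obtain ⟨z, rfl⟩ := hφ y
      exact DFunLike.congr_fun h z
  obtain ⟨hfin, hcard⟩ :=
    card_monoidHom_eq_of_sameFiniteQuotients_freeGroup hQ (Equiv.Perm (Fin (n + 1)))
  haveI := hfin
  have hbij := hinj.bijective_of_nat_card_le
    ((card_monoidHom_freeGroup k (Equiv.Perm (Fin (n + 1)))).trans hcard.symm).le
  obtain ⟨g, hg⟩ := hbij.2 f₀
  apply hf₀
  rw [← hg]
  change g (φ x) = 1
  rw [hx, map_one]

/-- **Jarden's corollary** (Dixon–Formanek–Poland–Ribes, Corollary to Thm. 3): a group generated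
by `k` elements which has exactly the finite quotients of `F_k` is free of rank `k`.  For the named
fact `isFreeOfRank_fundamentalGroup_of_sameFiniteQuotients` this isolates the topological content
as "`π₁(Y, y)` is generated by `k` elements". [cite: DixonFormanekPolandRibes1982, Corollary (Jarden) to Thm. 3] -/
theorem IsFreeOfRank.of_surjective_of_sameFiniteQuotients {k : ℕ} (φ : FreeGroup (Fin k) →* G)
    (hφ : Function.Surjective φ)
    (hQ : ∀ (Q : Type) [Group Q] [Finite Q],
      (∃ f : G →* Q, Function.Surjective f) ↔
        (∃ f : FreeGroup (Fin k) →* Q, Function.Surjective f)) :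
    IsFreeOfRank G k :=
  ⟨MulEquiv.ofBijective φ ⟨injective_of_surjective_of_sameFiniteQuotients φ hφ hQ, hφ⟩⟩

end Jarden

end Literature.Topology.FourManifolds
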